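import Literature.Probability.LatticeModels.PlaneRotatorStiffnessCutCovariance
import Literature.Probability.LatticeModels.PlaneRotatorComponentCorrelationInequality
import Literature.MathematicalPhysics.QuantumLattice.LatticeToriProofs
import HarnessLib

/-!
# The torus helicity modulus is controlled by the two-point function at distance `L/2`:
# `|βΥ_L(K)| ≤ 4K²L²·B²` whenever `⟨cos(θ_a − θ_c)⟩_{K,L} ≤ B` at column distance `≥ ⌊L/2⌋ − 1`

Topic `Literature/Probability/LatticeModels`. The REUSABLE ABSTRACTION behind
`PlaneRotatorStiffnessHighTemperatureLieb.lean` §3 (p548819, `abs_torusXYStiffness_le_lieb`: the case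
`B = (4u(K))^{⌊L/2⌋−1}` from Lieb's star criterion): the decay input is a hypothesis, so that ANY two-point bound at
distance `~L/2` — Lieb's star, Lieb's boxes of radius `R` (`PlaneRotatorTorusBoxCriterion.lean`), or a future one —
yields a bound on the helicity modulus of the nearest-neighbour plane rotator on `(ℤ/Lℤ)²`.

The two tree inputs composed here:

* the **cut–cut covariance identity** `βΥ_L(K) = −K²⟨J_{C_0} J_{C_m}⟩_{K,L}`, `m = ⌊L/2⌋`
  (`torusXYStiffness_eq_neg_sq_mul_cutCurrent_covariance`, `PlaneRotatorStiffnessCutCovariance.lean`;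
  Fisher–Barber–Jasnow 1973 §II / Sandvik 2010);
* the **component correlation inequality** (Dunlop–KPV / Bricmont–Fontaine–Landau 1977 Thm A2) as the bond-current
  decoupling `|⟨sin∇θ_{aa'} sin∇θ_{cc'}⟩| ≤ 2(G(a,c)G(a',c') + G(a,c')G(a',c))`, `G = ⟨cos(θ_x − θ_y)⟩ ≥ 0`
  (`abs_expectJ_imChar_mul_imChar_le_cosDiff`, `expectJ_reChar_diffChar_nonneg`,
  `PlaneRotatorComponentCorrelationInequality.lean`).

## Contents (everything PROVED; no definition, no named fact)

* §1 Plumbing (column sums of the cut profiles; linearity of `expectJ`; the column distances between the cuts `0`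
  and `⌊L/2⌋`; column distance `≤` torus distance).
* §2 **Main lemma** `abs_torusXYStiffness_le_of_twoPoint_bound`: `L ≥ 4`, `K ≥ 0`, `B ≥ 0`, and
  `⟨cos(θ_a − θ_c)⟩_{K,L} ≤ B` for all `a, c` at column distance `|valMinAbs(a₀ − c₀)| ≥ ⌊L/2⌋ − 1` ⟹
  `|βΥ_L(K)| ≤ 4K²L²·B²` (the `L × L` bond pairs across the two cuts contribute `≤ 4B²` each).
* §3 The same from a bound at TORUS (`ℓ^∞`) distance `≥ ⌊L/2⌋ − 1` (`…_of_twoPoint_bound_torusDist`), the form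
  decay criteria deliver; with the floor `0 ≤ βΥ_L` (`torusXYStiffness_mem_Icc_of_twoPoint_bound`).
* §4 The squeeze to `βΥ_L → 0` from an eventual majorant (`tendsto_torusXYStiffness_of_abs_le`).

Reading (cell `pub/hubbard-tc`, crux №2 classical side): `Υ_L` vanishes in the thermodynamic limit as soon as the
torus two-point function at distance `L/2` is `o(1/L)` uniformly — the dichotomy behind the typing rule (in the KT
phase `G ~ L^{−η}`, `η ≤ ¼`, and `Υ` survives).

## What this is not

A classical comparison-model lemma; no temperature regime by itself (the regime enters through the hypothesis `B`);
nothing electronic; no number of the cell's tables moves.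

## References

* M. E. Fisher, M. N. Barber, D. Jasnow, Phys. Rev. A 8 (1973) 1111, §II. [FisherBarberJasnow1973]
* J. Bricmont, J.-R. Fontaine, L. J. Landau, Comm. Math. Phys. 56 (1977) 281, Appendix Thm A2.
  [BricmontFontaineLandau1977]
* E. H. Lieb, Comm. Math. Phys. 77 (1980) 127, Theorem 4 (the first decay input). [Lieb1980]
-/

noncomputable section

open MeasureTheory Finset Filter
open scoped BigOperators Topology

namespace Literature.Probability.LatticeModels

open Literature.MathematicalPhysics.QuantumLattice

variable {L : ℕ} [NeZero L]

/-! ## §1 Plumbing -/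

section Plumbing

/-- A column has `L` sites: `∑_b cut_j(b) = L`. [cite: FisherBarberJasnow1973, §II — plumbing] -/
private theorem sum_cutProfile' (j : ZMod L) : ∑ b : TorusSite 2 L × Fin 2, cutProfile j b = (L : ℝ) := by
  rw [Fintype.sum_prod_type]
  have h : ∀ z : TorusSite 2 L, ∑ i : Fin 2, cutProfile j (z, i) = if z 0 = j then 1 else 0 := by
    intro z
    rw [Fin.sum_univ_two]
    simp [cutProfile]
  simp_rw [h]
  rw [Fintype.sum_equiv (finTwoArrowEquiv (ZMod L)) (fun z : TorusSite 2 L => if z 0 = j then (1 : ℝ) else 0)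
    (fun p => if p.1 = j then 1 else 0) (fun z => by simp [finTwoArrowEquiv]),
    Fintype.sum_prod_type]
  have hin : ∀ x : ZMod L, (∑ _y : ZMod L, if (x, _y).1 = j then (1 : ℝ) else 0) = if x = j then (L : ℝ) else 0 := by
    intro x
    have hf : (fun _y : ZMod L => if (x, _y).1 = j then (1 : ℝ) else 0) = fun _ => if x = j then 1 else 0 := rfl
    rw [hf, Finset.sum_const, Finset.card_univ, ZMod.card, nsmul_eq_mul]
    split_ifs <;> simp
  rw [Finset.sum_congr rfl fun x _ => hin x, Finset.sum_ite_eq' Finset.univ j, if_pos (Finset.mem_univ j)]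

omit [NeZero L] in
/-- `cut_j ≥ 0`. [cite: FisherBarberJasnow1973, §II — plumbing] -/
private theorem cutProfile_nonneg' (j : ZMod L) (b : TorusSite 2 L × Fin 2) : 0 ≤ cutProfile j b := by
  unfold cutProfile; split_ifs <;> norm_num

variable [MeasurableSpace Circle] [BorelSpace Circle]

/-- `⟨c·f⟩ = c⟨f⟩`. [cite: FisherBarberJasnow1973, §II — plumbing] -/
private theorem expectJ_const_mul'' (K c : ℝ) (f : (TorusSite 2 L → Circle) → ℝ) :
    (torusXY 2 L).expectJ (fun _ => K) (fun θ => c * f θ) = c * (torusXY 2 L).expectJ (fun _ => K) f := by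
  rw [(torusXY 2 L).expectJ_eq, (torusXY 2 L).expectJ_eq, ← mul_div_assoc, ← integral_const_mul]
  congr 1
  exact integral_congr_ae (ae_of_all _ fun θ => by ring)

/-- `⟨∑_i f_i⟩ = ∑_i ⟨f_i⟩` for continuous observables. [cite: FisherBarberJasnow1973, §II — plumbing] -/
private theorem expectJ_finset_sum'' {α : Type*} (K : ℝ) (S : Finset α) {f : α → (TorusSite 2 L → Circle) → ℝ}
    (hf : ∀ i, Continuous (f i)) :
    (torusXY 2 L).expectJ (fun _ => K) (fun θ => ∑ i ∈ S, f i θ) = ∑ i ∈ S, (torusXY 2 L).expectJ (fun _ => K) (f i) := by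
  simp only [(torusXY 2 L).expectJ_eq]
  rw [← Finset.sum_div]
  congr 1
  have hint : ∀ i ∈ S, Integrable (fun θ => f i θ * (torusXY 2 L).weightJ (fun _ => K) θ)
      (torusHaar (TorusSite 2 L)) := fun i _ =>
    integrable_torusHaar_of_continuous ((hf i).mul ((torusXY 2 L).continuous_weightJ _))
  rw [← integral_finsetSum _ hint]
  exact integral_congr_ae (ae_of_all _ fun θ => by simp only [Finset.sum_mul])

omit [NeZero L] [MeasurableSpace Circle] [BorelSpace Circle] in
/-- Column distances between the cuts `0` and `m = ⌊L/2⌋` and their shifts by `e₁` are all `≥ m − 1`.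
[cite: FisherBarberJasnow1973, §II — plumbing] -/
private theorem natAbs_valMinAbs_ge_of_near_half' (hL : 4 ≤ L) {a : ZMod L} {δ : ZMod L}
    (ha : a = ((L / 2 : ℕ) : ZMod L) + δ ∨ a = -(((L / 2 : ℕ) : ZMod L) + δ))
    (hδ : (δ.valMinAbs).natAbs ≤ 1) : L / 2 - 1 ≤ (a.valMinAbs).natAbs := by
  have hm : ((((L / 2 : ℕ) : ZMod L)).valMinAbs).natAbs = L / 2 := by
    rw [ZMod.valMinAbs_natCast_of_le_half (le_refl _), Int.natAbs_natCast]
  have key : L / 2 ≤ ((((L / 2 : ℕ) : ZMod L) + δ).valMinAbs).natAbs + 1 := by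
    have e : ((L / 2 : ℕ) : ZMod L) = (((L / 2 : ℕ) : ZMod L) + δ) + (-δ) := by ring
    have h := ZMod.natAbs_valMinAbs_add_le ((((L / 2 : ℕ) : ZMod L)) + δ) (-δ)
    rw [← e, hm] at h
    have h2 := (h.trans (Int.natAbs_add_le _ _))
    rw [ZMod.natAbs_valMinAbs_neg] at h2
    omega
  rcases ha with h | h
  · rw [h]; omega
  · rw [h, ZMod.natAbs_valMinAbs_neg]; omega

omit [MeasurableSpace Circle] [BorelSpace Circle] in
/-- **Column distance `≤` torus distance**: `|valMinAbs(a₀ − c₀)| ≤ dist_∞(a, c)` (the first coordinate of the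
periodic sup norm; `|valMinAbs z| = min(z.val, L − z.val)`). [cite: FriedliVelenik2017, §3.1 (periodic sup norm)] -/
theorem natAbs_valMinAbs_sub_le_torusDist (a c : TorusSite 2 L) :
    ((a 0 - c 0).valMinAbs).natAbs ≤ torusDist a c := by
  rw [torusDist, torusNorm, ZMod.valMinAbs_natAbs_eq_min, show a 0 - c 0 = (a - c) 0 from rfl]
  exact Finset.le_sup (f := fun i => min ((a - c) i).val (L - ((a - c) i).val)) (Finset.mem_univ 0)

end Plumbing

/-! ## §2 The main lemma -/

section Main

variable [MeasurableSpace Circle] [BorelSpace Circle]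

/-- **The helicity modulus is bounded by the square of the two-point function at distance `~L/2`.** For `L ≥ 4`,
`K ≥ 0`, `B ≥ 0`: if `⟨cos(θ_a − θ_c)⟩_{K,L} ≤ B` for all sites `a, c` of `(ℤ/Lℤ)²` at column distance
`|valMinAbs(a₀ − c₀)| ≥ ⌊L/2⌋ − 1`, then

  `|βΥ_L(K)| ≤ 4K²L²·B²`.

Proof: `βΥ_L = −K²⟨J_{C_0} J_{C_m}⟩`, `m = ⌊L/2⌋` (cut–cut covariance identity); the covariance is a double sum over
the `L × L` pairs of bonds of the two cuts of bond-current correlations, each bounded by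
`2(G(a,c)G(a',c') + G(a,c')G(a',c)) ≤ 4B²` (component correlation inequality, `0 ≤ G ≤ B` at all four column
distances `≥ m − 1`). [cite: BricmontFontaineLandau1977, Appendix Thm A2 (decoupling input); FisherBarberJasnow1973 §II (Υ as a current response)] -/
theorem abs_torusXYStiffness_le_of_twoPoint_bound (hL : 4 ≤ L) {K B : ℝ} (hK : 0 ≤ K) (hB : 0 ≤ B)
    (hG : ∀ a c : TorusSite 2 L, L / 2 - 1 ≤ ((a 0 - c 0).valMinAbs).natAbs →
      (torusXY 2 L).expectJ (fun _ => K) (cosDiff a c) ≤ B) :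
    |torusXYStiffness L K| ≤ 4 * K ^ 2 * (L : ℝ) ^ 2 * B ^ 2 := by
  classical
  set m : ℕ := L / 2 with hm
  -- the two cuts `0` and `m`
  have hj : (0 : ZMod L) ≠ ((m : ℕ) : ZMod L) := by
    intro h
    have h' : ((m : ℕ) : ZMod L) = 0 := h.symm
    rw [ZMod.natCast_eq_zero_iff] at h'
    have : m < L := by omega
    have : 0 < m := by omega
    exact absurd (Nat.le_of_dvd this h') (by omega)
  rw [torusXYStiffness_eq_neg_sq_mul_cutCurrent_covariance K hj, abs_neg, abs_mul, abs_of_nonneg (sq_nonneg K)]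
  -- the Ginibre floor and the hypothesis as one `Icc` statement
  have hIcc : ∀ a c : TorusSite 2 L, m - 1 ≤ ((a 0 - c 0).valMinAbs).natAbs →
      (torusXY 2 L).expectJ (fun _ => K) (cosDiff a c) ∈ Set.Icc 0 B := by
    intro a c hac
    refine ⟨?_, hG a c hac⟩
    have h := (torusXY 2 L).expectJ_reChar_diffChar_nonneg (J := fun _ => K) (fun _ => hK) a c
    have e : (cosDiff a c : (TorusSite 2 L → Circle) → ℝ) = reChar (diffChar a c) :=
      funext fun θ => cosDiff_eq_reChar a c θ
    rw [e]; exact h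
  -- the covariance as a double sum of bond-current correlations
  have hexp : (torusXY 2 L).expectJ (fun _ => K) (fun θ => cutCurrent 0 θ * cutCurrent (m : ZMod L) θ) =
      ∑ b, ∑ b', cutProfile 0 b * cutProfile (m : ZMod L) b' *
        (torusXY 2 L).expectJ (fun _ => K)
          (fun θ => imChar ((torusXY 2 L).bondChar b) θ * imChar ((torusXY 2 L).bondChar b') θ) := by
    have e : (fun θ => cutCurrent 0 θ * cutCurrent (m : ZMod L) θ) = fun θ : TorusSite 2 L → Circle =>
        ∑ b, ∑ b', cutProfile 0 b * cutProfile (m : ZMod L) b' *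
          (imChar ((torusXY 2 L).bondChar b) θ * imChar ((torusXY 2 L).bondChar b') θ) := by
      funext θ
      simp only [cutCurrent, Finset.sum_mul_sum]
      exact Finset.sum_congr rfl fun b _ => Finset.sum_congr rfl fun b' _ => by ring
    have hcont : ∀ b b' : TorusSite 2 L × Fin 2, Continuous fun θ : TorusSite 2 L → Circle =>
        imChar ((torusXY 2 L).bondChar b) θ * imChar ((torusXY 2 L).bondChar b') θ := fun b b' =>
      (continuous_imChar _).mul (continuous_imChar _)
    have hc2 : ∀ b b' : TorusSite 2 L × Fin 2, Continuous fun θ : TorusSite 2 L → Circle =>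
        cutProfile 0 b * cutProfile (m : ZMod L) b' *
          (imChar ((torusXY 2 L).bondChar b) θ * imChar ((torusXY 2 L).bondChar b') θ) := fun b b' =>
      continuous_const.mul (hcont b b')
    have hc1 : ∀ b : TorusSite 2 L × Fin 2, Continuous fun θ : TorusSite 2 L → Circle =>
        ∑ b', cutProfile 0 b * cutProfile (m : ZMod L) b' *
          (imChar ((torusXY 2 L).bondChar b) θ * imChar ((torusXY 2 L).bondChar b') θ) := fun b =>
      continuous_finsetSum _ fun b' _ => hc2 b b'
    rw [e, expectJ_finset_sum'' K Finset.univ (f := fun b θ => ∑ b', cutProfile 0 b * cutProfile (m : ZMod L) b' *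
      (imChar ((torusXY 2 L).bondChar b) θ * imChar ((torusXY 2 L).bondChar b') θ)) hc1]
    refine Finset.sum_congr rfl fun b _ => ?_
    rw [expectJ_finset_sum'' K Finset.univ (f := fun b' θ => cutProfile 0 b * cutProfile (m : ZMod L) b' *
      (imChar ((torusXY 2 L).bondChar b) θ * imChar ((torusXY 2 L).bondChar b') θ)) (hc2 b)]
    refine Finset.sum_congr rfl fun b' _ => ?_
    rw [← expectJ_const_mul'']
  rw [hexp]
  -- termwise bound `cut·cut·|X| ≤ cut·cut·4B²`
  have hterm : ∀ b b' : TorusSite 2 L × Fin 2,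
      |cutProfile 0 b * cutProfile (m : ZMod L) b' *
        (torusXY 2 L).expectJ (fun _ => K)
          (fun θ => imChar ((torusXY 2 L).bondChar b) θ * imChar ((torusXY 2 L).bondChar b') θ)| ≤
        cutProfile 0 b * cutProfile (m : ZMod L) b' * (4 * B ^ 2) := by
    rintro ⟨z, i⟩ ⟨z', i'⟩
    unfold cutProfile
    by_cases hb : i = 0 ∧ z 0 = 0
    · by_cases hb' : i' = 0 ∧ z' 0 = (m : ZMod L)
      · obtain ⟨hi, hz⟩ := hb
        obtain ⟨hi', hz'⟩ := hb'
        subst hi; subst hi'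
        rw [if_pos ⟨rfl, hz⟩, if_pos ⟨rfl, hz'⟩]
        simp only [one_mul]
        -- the decoupling by the component correlation inequality
        have hdec := (torusXY 2 L).abs_expectJ_imChar_mul_imChar_le_cosDiff (J := fun _ => K) (fun _ => hK)
          z (z + Pi.single 0 1) z' (z' + Pi.single 0 1)
        have hbc : ∀ w : TorusSite 2 L, (torusXY 2 L).bondChar (w, 0) = diffChar w (w + Pi.single 0 1) :=
          fun w => rfl
        rw [hbc, hbc]
        refine hdec.trans ?_
        -- the four two-point functions, all at column distance `≥ m − 1`
        have hδ1 : ((1 : ZMod L).valMinAbs).natAbs ≤ 1 := by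
          have h := ZMod.valMinAbs_natCast_of_le_half (n := L) (a := 1) (by omega)
          rw [Nat.cast_one] at h; rw [h]; norm_num
        have hδ0 : ((0 : ZMod L).valMinAbs).natAbs ≤ 1 := by rw [ZMod.valMinAbs_zero]; norm_num
        have e1 : (z + Pi.single (0 : Fin 2) 1 : TorusSite 2 L) 0 = z 0 + 1 := by
          rw [Pi.add_apply, Pi.single_eq_same]
        have e1' : (z' + Pi.single (0 : Fin 2) 1 : TorusSite 2 L) 0 = z' 0 + 1 := by
          rw [Pi.add_apply, Pi.single_eq_same]
        have G1 := hIcc z z'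
          (natAbs_valMinAbs_ge_of_near_half' hL (δ := 0) (Or.inr (by rw [hz, hz']; ring)) hδ0)
        have G2 := hIcc (z + Pi.single 0 1) (z' + Pi.single 0 1)
          (natAbs_valMinAbs_ge_of_near_half' hL (δ := 0) (Or.inr (by rw [e1, e1', hz, hz']; ring)) hδ0)
        have G3 := hIcc z (z' + Pi.single 0 1)
          (natAbs_valMinAbs_ge_of_near_half' hL (δ := 1) (Or.inr (by rw [e1', hz, hz']; ring)) hδ1)
        have G4 := hIcc (z + Pi.single 0 1) z'
          (natAbs_valMinAbs_ge_of_near_half' hL (δ := -1) (Or.inr (by rw [e1, hz, hz']; ring))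
            (by rw [ZMod.natAbs_valMinAbs_neg]; exact hδ1))
        obtain ⟨g1l, g1u⟩ := G1
        obtain ⟨g2l, g2u⟩ := G2
        obtain ⟨g3l, g3u⟩ := G3
        obtain ⟨g4l, g4u⟩ := G4
        have p1 := mul_le_mul g1u g2u g2l hB
        have p2 := mul_le_mul g3u g4u g4l hB
        nlinarith
      · rw [if_neg hb']; simp
    · rw [if_neg hb]; simp
  -- sum up
  calc K ^ 2 * |∑ b, ∑ b', cutProfile 0 b * cutProfile (m : ZMod L) b' *
          (torusXY 2 L).expectJ (fun _ => K)
            (fun θ => imChar ((torusXY 2 L).bondChar b) θ * imChar ((torusXY 2 L).bondChar b') θ)|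
      ≤ K ^ 2 * ∑ b, ∑ b', cutProfile 0 b * cutProfile (m : ZMod L) b' * (4 * B ^ 2) := by
        refine mul_le_mul_of_nonneg_left ?_ (sq_nonneg K)
        refine (Finset.abs_sum_le_sum_abs _ _).trans (Finset.sum_le_sum fun b _ => ?_)
        exact (Finset.abs_sum_le_sum_abs _ _).trans (Finset.sum_le_sum fun b' _ => hterm b b')
    _ = 4 * K ^ 2 * (L : ℝ) ^ 2 * B ^ 2 := by
        have h : ∑ b, ∑ b', cutProfile (0 : ZMod L) b * cutProfile (m : ZMod L) b' * (4 * B ^ 2) =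
            (∑ b, cutProfile (0 : ZMod L) b) * (∑ b', cutProfile (m : ZMod L) b') * (4 * B ^ 2) := by
          rw [Finset.sum_mul_sum, Finset.sum_mul]
          refine Finset.sum_congr rfl fun b _ => ?_
          rw [Finset.sum_mul]
        rw [h, sum_cutProfile', sum_cutProfile']
        ring

end Main

/-! ## §3 The bound from a two-point bound at torus distance `≥ ⌊L/2⌋ − 1` -/

section TorusDist

variable [MeasurableSpace Circle] [BorelSpace Circle]

/-- **Torus-distance form** (the shape decay criteria deliver): for `L ≥ 4`, `K ≥ 0`, `B ≥ 0`, if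
`⟨cos(θ_a − θ_c)⟩_{K,L} ≤ B` for all `a, c` with `dist_∞(a, c) ≥ ⌊L/2⌋ − 1`, then `|βΥ_L(K)| ≤ 4K²L²·B²`
(column distance `≤` torus distance). [cite: BricmontFontaineLandau1977, Appendix Thm A2; FisherBarberJasnow1973 §II] -/
theorem abs_torusXYStiffness_le_of_twoPoint_bound_torusDist (hL : 4 ≤ L) {K B : ℝ} (hK : 0 ≤ K) (hB : 0 ≤ B)
    (hG : ∀ a c : TorusSite 2 L, L / 2 - 1 ≤ torusDist a c →
      (torusXY 2 L).expectJ (fun _ => K) (cosDiff a c) ≤ B) :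
    |torusXYStiffness L K| ≤ 4 * K ^ 2 * (L : ℝ) ^ 2 * B ^ 2 :=
  abs_torusXYStiffness_le_of_twoPoint_bound hL hK hB fun a c hac =>
    hG a c (hac.trans (natAbs_valMinAbs_sub_le_torusDist a c))

/-- The same with the tree's stiffness floor: **`0 ≤ βΥ_L(K) ≤ 4K²L²·B²`**. [cite: BricmontFontaineLandau1977, Appendix Thm A2; FisherBarberJasnow1973 §II] -/
theorem torusXYStiffness_mem_Icc_of_twoPoint_bound (hL : 4 ≤ L) {K B : ℝ} (hK : 0 ≤ K) (hB : 0 ≤ B)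
    (hG : ∀ a c : TorusSite 2 L, L / 2 - 1 ≤ torusDist a c →
      (torusXY 2 L).expectJ (fun _ => K) (cosDiff a c) ≤ B) :
    torusXYStiffness L K ∈ Set.Icc 0 (4 * K ^ 2 * (L : ℝ) ^ 2 * B ^ 2) :=
  ⟨torusXYStiffness_nonneg hK,
    (le_abs_self _).trans (abs_torusXYStiffness_le_of_twoPoint_bound_torusDist hL hK hB hG)⟩

/-- **The `o(1/L)` dichotomy**: if along the tori `L + 1` the two-point function at torus distance `≥ ⌊(L+1)/2⌋ − 1`
is eventually bounded by `B_L ≥ 0` with `(L+1)·B_L → 0`, then `βΥ_{L+1}(K) → 0`. [cite: FisherBarberJasnow1973, §II (helicity modulus); BricmontFontaineLandau1977 Appendix Thm A2] -/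
theorem tendsto_torusXYStiffness_of_twoPoint_bound {K : ℝ} (hK : 0 ≤ K) {B : ℕ → ℝ} (hB : ∀ L, 0 ≤ B L)
    (hG : ∀ᶠ L : ℕ in atTop, ∀ a c : TorusSite 2 (L + 1), (L + 1) / 2 - 1 ≤ torusDist a c →
      (torusXY 2 (L + 1)).expectJ (fun _ => K) (cosDiff a c) ≤ B L)
    (hlim : Tendsto (fun L : ℕ => ((L : ℝ) + 1) * B L) atTop (𝓝 0)) :
    Tendsto (fun L : ℕ => torusXYStiffness (L + 1) K) atTop (𝓝 0) := by
  -- the majorant `4K²((L+1)B_L)²`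
  have hmaj : Tendsto (fun L : ℕ => 4 * K ^ 2 * (((L : ℝ) + 1) * B L) ^ 2) atTop (𝓝 0) := by
    have := (hlim.pow 2).const_mul (4 * K ^ 2)
    simpa using this
  refine tendsto_of_tendsto_of_tendsto_of_le_of_le' tendsto_const_nhds hmaj ?_ ?_
  · exact Eventually.of_forall fun L => torusXYStiffness_nonneg hK
  · filter_upwards [hG, eventually_ge_atTop 3] with L hGL hL3
    have hb := abs_torusXYStiffness_le_of_twoPoint_bound_torusDist (L := L + 1) (by omega) hK (hB L) hGL
    refine ((le_abs_self _).trans hb).trans (le_of_eq ?_)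
    push_cast
    ring

end TorusDist

/-! ## §4 The squeeze -/

section Squeeze

variable [MeasurableSpace Circle] [BorelSpace Circle]

/-- **Squeeze for the helicity modulus**: an eventual majorant `|βΥ_{L+1}(K)| ≤ f(L)` with `f → 0` gives
`βΥ_{L+1}(K) → 0` (`K ≥ 0`, floor `0 ≤ βΥ_L`). [cite: FisherBarberJasnow1973, §II (helicity modulus)] -/
theorem tendsto_torusXYStiffness_of_abs_le {K : ℝ} (hK : 0 ≤ K) {f : ℕ → ℝ} (hf : Tendsto f atTop (𝓝 0))
    (h : ∀ᶠ L : ℕ in atTop, |torusXYStiffness (L + 1) K| ≤ f L) :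
    Tendsto (fun L : ℕ => torusXYStiffness (L + 1) K) atTop (𝓝 0) := by
  refine tendsto_of_tendsto_of_tendsto_of_le_of_le' tendsto_const_nhds hf ?_ ?_
  · exact Eventually.of_forall fun L => torusXYStiffness_nonneg hK
  · filter_upwards [h] with L hL
    exact (le_abs_self _).trans hL

end Squeeze

end Literature.Probability.LatticeModels
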